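/-
Solo-blind KontsevichZagierPeriods, session s21 — Lyndon words in Deligne's order and the standard
bracketing: the standard bracketing of a Lyndon word is a GOOD tree with the right leaf word.
-/
import Summits.KontsevichZagierPeriods.KontsevichZagierPeriods.Theorems.SoloBlindLieTrees

/-!
# Lyndon words and the goodness of the standard bracketing

`SoloBlindLieTrees` proves (Λ1′)/(Λ2′) for GOOD bracket trees — trees in which, at every node
`[l, r]`, the value word of `l ++ r` is Deligne-smaller than that of `r ++ l` — and the corner
theorems (T1)–(T3) of the solo-blind notes are stated for good trees.  This file supplies the
trees.  For a word `w` with letters in any type `ι` and degrees `deg : ι → ℕ` that is LYNDON for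
Deligne's order on value words (`w` is smaller than each of its proper nonempty suffixes), the
STANDARD BRACKETING — split off the Deligne-minimal proper nonempty suffix as the right factor,
recurse on both factors — is a good tree whose leaf word is `w`:

* order lemmas: `dlex_append_left_iff` (cancellation), `dlex_trichot`, `prefix_or_dlex_append`
  (if `s ≺ u` then `s` is a prefix of `u` or `s ++ X ≺ u ++ Y` for all `X, Y`);
* `IsLyndon deg w`; `minSuf deg x` (the minimal nonempty suffix): `minSuf_suffix`,
  `minSuf_ne_nil`, `not_dlex_minSuf` (minimality), `isLyndon_minSuf` (it is Lyndon);
* `isLyndon_left` — the standard-factorisation lemma: the left factor is Lyndon;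
  `dlex_append_swap` — a Lyndon word `u ++ v` is smaller than `v ++ u`;
* `stdBr deg f a x` (standard bracketing of `a :: x` with fuel `f ≥ x.length`),
  `standardBracketing`, and the theorem `stdBr_spec` / `word_standardBracketing` /
  `good_standardBracketing`: `IsLyndon deg (a :: x) → word T = a :: x ∧ Good deg T`;
  consequences `not_dlex_of_mem_terms_std` (Λ2′) and `eq_reverse_of_mem_terms_std` (Λ1′).

With `ι` = the positions of the letters of an odd Lyndon word `n` and `deg` = the letter values,
this discharges the hypothesis "the tree is good" of the corner theorems for the element `P_n` of
the notes (hodge.md 8.12.4).  Pure list combinatorics; nothing about periods is claimed here.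
-/

namespace Summit.KontsevichZagierPeriods.KontsevichZagierPeriods.Theorems

namespace SoloBlind

namespace LyndonWords

open LieTrees LieTrees.BTree

variable {ι : Type*}

/-! ## More on Deligne's order -/

/-- Deligne's order is decidable (it is `List.Lex` of a decidable relation). -/
instance decDLex (x y : List ℕ) : Decidable (DLex x y) :=
  inferInstanceAs (Decidable (List.Lex (fun a b : ℕ => b < a) x y))

/-- Appending to the larger word keeps the comparison. -/
theorem dlex_append_right {x y : List ℕ} (z : List ℕ) (h : DLex x y) : DLex x (y ++ z) :=
  List.Lex.append_right _ z h

/-- Cancelling a common prefix. -/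
theorem dlex_append_left_iff : ∀ (s : List ℕ) {x y : List ℕ},
    DLex (s ++ x) (s ++ y) ↔ DLex x y
  | [], _, _ => Iff.rfl
  | a :: s, x, y => by
    rw [List.cons_append, List.cons_append, dlex_cons_iff, dlex_append_left_iff s]
    constructor
    · rintro (h | ⟨_, h⟩)
      · exact (lt_irrefl a h).elim
      · exact h
    · exact fun h => Or.inr ⟨rfl, h⟩

/-- Asymmetry. -/
theorem dlex_asymm {x y : List ℕ} (h : DLex x y) : ¬ DLex y x :=
  fun h' => dlex_irrefl x (dlex_trans h h')

/-- Trichotomy for distinct words of arbitrary lengths. -/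
theorem dlex_trichot : ∀ {x y : List ℕ}, x ≠ y → DLex x y ∨ DLex y x
  | [], [], h => (h rfl).elim
  | [], _ :: _, _ => Or.inl List.Lex.nil
  | _ :: _, [], _ => Or.inr List.Lex.nil
  | a :: x, b :: y, hne => by
    rcases lt_trichotomy a b with h | rfl | h
    · exact Or.inr (dlex_cons_iff.mpr (Or.inl h))
    · have hxy : x ≠ y := fun e => hne (by rw [e])
      rcases dlex_trichot hxy with h | h
      · exact Or.inl (dlex_cons_iff.mpr (Or.inr ⟨rfl, h⟩))
      · exact Or.inr (dlex_cons_iff.mpr (Or.inr ⟨rfl, h⟩))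
    · exact Or.inl (dlex_cons_iff.mpr (Or.inl h))

/-- Prefix dichotomy: if `s ≺ u` then either `s` is a prefix of `u`, or the comparison is decided
inside the two words and survives arbitrary continuations. -/
theorem prefix_or_dlex_append : ∀ {s u : List ℕ}, DLex s u →
    s <+: u ∨ ∀ X Y : List ℕ, DLex (s ++ X) (u ++ Y)
  | [], _, _ => Or.inl List.nil_prefix
  | _ :: _, [], h => (not_dlex_nil _ h).elim
  | c :: s, d :: u, h => by
    rcases dlex_cons_iff.mp h with hdc | ⟨hcd, h'⟩
    · exact Or.inr fun X Y => dlex_cons_iff.mpr (Or.inl hdc)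
    · subst hcd
      rcases prefix_or_dlex_append h' with hp | hp
      · exact Or.inl (List.cons_prefix_cons.mpr ⟨rfl, hp⟩)
      · exact Or.inr fun X Y => dlex_cons_iff.mpr (Or.inr ⟨rfl, hp X Y⟩)

/-- A proper suffix is strictly shorter. -/
theorem length_lt_of_suffix_of_ne {s w : List ι} (hs : s <:+ w) (hne : s ≠ w) :
    s.length < w.length := by
  rcases Nat.lt_or_ge s.length w.length with h | h
  · exact h
  · exfalso
    have hl : s.length = w.length := le_antisymm hs.length_le h
    apply hne
    have h' := List.suffix_iff_eq_drop.mp hs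
    rw [hl, Nat.sub_self, List.drop_zero] at h'
    exact h'

/-! ## Lyndon words in Deligne's order; the minimal suffix -/

/-- `w` is LYNDON for the degrees `deg` (in Deligne's order): it is nonempty and its value word
is smaller than the value word of each proper nonempty suffix. -/
def IsLyndon (deg : ι → ℕ) (w : List ι) : Prop :=
  w ≠ [] ∧ ∀ s : List ι, s <:+ w → s ≠ [] → s ≠ w → DLex (w.map deg) (s.map deg)

/-- The Deligne-minimal nonempty suffix of a word (`[]` for the empty word). -/
def minSuf (deg : ι → ℕ) : List ι → List ι
  | [] => []
  | [a] => [a]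
  | a :: b :: x =>
      if DLex ((a :: b :: x).map deg) ((minSuf deg (b :: x)).map deg) then a :: b :: x
      else minSuf deg (b :: x)

/-- `minSuf` is a suffix. -/
theorem minSuf_suffix (deg : ι → ℕ) : ∀ w : List ι, minSuf deg w <:+ w
  | [] => List.suffix_refl _
  | [_] => List.suffix_refl _
  | a :: b :: x => by
    simp only [minSuf]
    split
    · exact List.suffix_refl _
    · exact (minSuf_suffix deg (b :: x)).trans (List.suffix_cons a (b :: x))

/-- `minSuf` of a nonempty word is nonempty. -/
theorem minSuf_ne_nil (deg : ι → ℕ) : ∀ {w : List ι}, w ≠ [] → minSuf deg w ≠ []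
  | [], h => (h rfl).elim
  | [_], _ => by simp [minSuf]
  | a :: b :: x, _ => by
    simp only [minSuf]
    split
    · exact List.cons_ne_nil _ _
    · exact minSuf_ne_nil deg (List.cons_ne_nil _ _)

/-- MINIMALITY: no nonempty suffix is Deligne-smaller than `minSuf`. -/
theorem not_dlex_minSuf (deg : ι → ℕ) : ∀ (w s : List ι), s <:+ w → s ≠ [] →
    ¬ DLex (s.map deg) ((minSuf deg w).map deg)
  | [], s, hs, hne => (hne (List.suffix_nil.mp hs)).elim
  | [a], s, hs, hne => by
    rcases List.suffix_cons_iff.mp hs with rfl | hs'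
    · exact dlex_irrefl _
    · exact (hne (List.suffix_nil.mp hs')).elim
  | a :: b :: x, s, hs, hne => by
    simp only [minSuf]
    split
    · rename_i hlt
      rcases List.suffix_cons_iff.mp hs with rfl | hs'
      · exact dlex_irrefl _
      · exact fun h => not_dlex_minSuf deg (b :: x) s hs' hne (dlex_trans h hlt)
    · rename_i hge
      rcases List.suffix_cons_iff.mp hs with rfl | hs'
      · exact hge
      · exact not_dlex_minSuf deg (b :: x) s hs' hne

/-- The minimal nonempty suffix of a nonempty word is Lyndon. -/
theorem isLyndon_minSuf (deg : ι → ℕ) {x : List ι} (hx : x ≠ []) :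
    IsLyndon deg (minSuf deg x) := by
  refine ⟨minSuf_ne_nil deg hx, fun s hs hne hsv => ?_⟩
  have hlen : s.length < (minSuf deg x).length := length_lt_of_suffix_of_ne hs hsv
  have hne' : (minSuf deg x).map deg ≠ s.map deg := fun h => by
    have := congrArg List.length h
    simp only [List.length_map] at this
    omega
  rcases dlex_trichot hne' with h | h
  · exact h
  · exact (not_dlex_minSuf deg x s (hs.trans (minSuf_suffix deg x)) hne h).elim

/-! ## The standard factorisation -/

/-- THE STANDARD-FACTORISATION LEMMA.  If `p ++ v` is Lyndon (`p`, `v` nonempty) and no suffix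
`t ++ v` with `t` a proper suffix of `p` is smaller than `v` (e.g. `v` is the minimal proper
nonempty suffix), then the left factor `p` is Lyndon. -/
theorem isLyndon_left (deg : ι → ℕ) {p v : List ι} (hp : p ≠ []) (hv : v ≠ [])
    (hw : IsLyndon deg (p ++ v))
    (hmin : ∀ t : List ι, t <:+ p → t ≠ p → ¬ DLex ((t ++ v).map deg) (v.map deg)) :
    IsLyndon deg p := by
  refine ⟨hp, fun s hs hne hsp => ?_⟩
  have hlen : s.length < p.length := length_lt_of_suffix_of_ne hs hsp
  have hspos : 0 < s.length :=
    Nat.pos_of_ne_zero fun h0 => hne (List.eq_nil_of_length_eq_zero h0)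
  -- the proper nonempty suffix `s ++ v` of the Lyndon word `p ++ v`
  have hsv : DLex ((p ++ v).map deg) ((s ++ v).map deg) := by
    refine hw.2 (s ++ v) ?_ (by simp [hv]) ?_
    · obtain ⟨t, rfl⟩ := hs
      exact ⟨t, (List.append_assoc t s v).symm⟩
    · intro h
      have := congrArg List.length h
      simp only [List.length_append] at this
      omega
  have hne' : p.map deg ≠ s.map deg := fun h => by
    have := congrArg List.length h
    simp only [List.length_map] at this
    omega
  rcases dlex_trichot hne' with h | h
  · exact h
  · exfalso
    rcases prefix_or_dlex_append h with hpre | hsep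
    · -- `s` is a proper prefix of `p` in values: `p = s' ++ t`, `s'` with the values of `s`
      set t := p.drop s.length with ht
      have hpt : p.map deg = s.map deg ++ t.map deg := by
        rw [List.prefix_iff_eq_take.mp hpre, List.length_map, ht, List.map_drop,
          List.take_append_drop]
      have h2 : DLex ((t ++ v).map deg) (v.map deg) := by
        rw [List.map_append, List.map_append, hpt, List.append_assoc,
          dlex_append_left_iff] at hsv
        rwa [List.map_append]
      refine hmin t (by rw [ht]; exact List.drop_suffix _ _) ?_ h2
      intro htp
      have := congrArg List.length htp
      rw [ht, List.length_drop] at this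
      omega
    · exact dlex_asymm hsv (by simpa [List.map_append] using hsep (v.map deg) (v.map deg))

/-- A Lyndon word `u ++ v` (both parts nonempty) is Deligne-smaller than `v ++ u`: the node
condition of a good tree. -/
theorem dlex_append_swap (deg : ι → ℕ) {u v : List ι} (hu : u ≠ []) (hv : v ≠ [])
    (hw : IsLyndon deg (u ++ v)) :
    DLex (u.map deg ++ v.map deg) (v.map deg ++ u.map deg) := by
  have h : DLex ((u ++ v).map deg) (v.map deg) := by
    refine hw.2 v ⟨u, rfl⟩ hv ?_
    intro h
    have := congrArg List.length h
    simp only [List.length_append] at this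
    exact hu (List.eq_nil_of_length_eq_zero (by omega))
  rw [List.map_append] at h
  exact dlex_append_right _ h

/-! ## The standard bracketing -/

/-- The standard bracketing of the word `a :: x` with fuel `f` (any `f ≥ x.length` gives the
standard bracketing): the right factor is the Deligne-minimal proper nonempty suffix, and both
factors are bracketed recursively. -/
def stdBr (deg : ι → ℕ) : ℕ → ι → List ι → BTree ι
  | 0, a, _ => leaf a
  | _ + 1, a, [] => leaf a
  | f + 1, a, b :: x =>
    match minSuf deg (b :: x) with
    | [] => leaf a
    | c :: y => node (stdBr deg f a ((b :: x).take (x.length - y.length))) (stdBr deg f c y)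

/-- The standard bracketing of the nonempty word `a :: x`. -/
def standardBracketing (deg : ι → ℕ) (a : ι) (x : List ι) : BTree ι :=
  stdBr deg x.length a x

/-- Unfolding the recursive case. -/
theorem stdBr_succ_cons (deg : ι → ℕ) (f : ℕ) (a b : ι) (x : List ι) {c : ι} {y : List ι}
    (hm : minSuf deg (b :: x) = c :: y) :
    stdBr deg (f + 1) a (b :: x) =
      node (stdBr deg f a ((b :: x).take (x.length - y.length))) (stdBr deg f c y) := by
  simp only [stdBr, hm]

/-- Splitting a word in front of its minimal nonempty suffix. -/
theorem take_append_minSuf (deg : ι → ℕ) (b : ι) (x : List ι) {c : ι} {y : List ι}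
    (hm : minSuf deg (b :: x) = c :: y) :
    (b :: x).take (x.length - y.length) ++ (c :: y) = b :: x := by
  have hs : c :: y <:+ b :: x := hm ▸ minSuf_suffix deg (b :: x)
  obtain ⟨t, ht⟩ := hs
  have hlen : t.length = x.length - y.length := by
    have := congrArg List.length ht
    simp only [List.length_append, List.length_cons] at this
    omega
  rw [← hlen, ← ht, List.take_append_of_le_length le_rfl, List.take_length]

/-- MAIN THEOREM.  For a Lyndon word `a :: x` and fuel `f ≥ x.length`, the standard bracketing
has leaf word `a :: x` and is a GOOD tree (node condition from `dlex_append_swap`, recursion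
through `isLyndon_left` and `isLyndon_minSuf`). -/
theorem stdBr_spec (deg : ι → ℕ) : ∀ (f : ℕ) (a : ι) (x : List ι), x.length ≤ f →
    IsLyndon deg (a :: x) → word (stdBr deg f a x) = a :: x ∧ Good deg (stdBr deg f a x)
  | 0, a, x, hf, _ => by
    obtain rfl : x = [] := List.eq_nil_of_length_eq_zero (Nat.le_zero.mp hf)
    exact ⟨rfl, trivial⟩
  | _ + 1, a, [], _, _ => ⟨rfl, trivial⟩
  | f + 1, a, b :: x, hf, hL => by
    have hxf : x.length ≤ f := by
      simp only [List.length_cons] at hf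
      omega
    obtain ⟨c, y, hm⟩ : ∃ c y, minSuf deg (b :: x) = c :: y :=
      List.exists_cons_of_ne_nil (minSuf_ne_nil deg (List.cons_ne_nil b x))
    rw [stdBr_succ_cons deg f a b x hm]
    have hsplit := take_append_minSuf deg b x hm
    set u := (b :: x).take (x.length - y.length) with hu
    have hsuf : c :: y <:+ b :: x := hm ▸ minSuf_suffix deg (b :: x)
    have hylen : y.length ≤ f := by
      have := hsuf.length_le
      simp only [List.length_cons] at this
      omega
    have hulen : u.length ≤ f := by
      rw [hu, List.length_take]
      simp only [List.length_cons]
      omega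
    have hw : a :: b :: x = (a :: u) ++ (c :: y) := by rw [List.cons_append, hsplit]
    have hRight : IsLyndon deg (c :: y) := by
      rw [← hm]
      exact isLyndon_minSuf deg (List.cons_ne_nil b x)
    have hLeft : IsLyndon deg (a :: u) := by
      refine isLyndon_left deg (List.cons_ne_nil a u) (List.cons_ne_nil c y) (hw ▸ hL) ?_
      intro t ht htne
      have htu : t <:+ u := by
        rcases List.suffix_cons_iff.mp ht with rfl | h
        · exact (htne rfl).elim
        · exact h
      have h1 : t ++ (c :: y) <:+ b :: x := by
        obtain ⟨r, hr⟩ := htu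
        exact ⟨r, by rw [← List.append_assoc, hr, hsplit]⟩
      have h2 := not_dlex_minSuf deg (b :: x) (t ++ (c :: y)) h1 (by simp)
      rwa [hm] at h2
    obtain ⟨hwl, hgl⟩ := stdBr_spec deg f a u hulen hLeft
    obtain ⟨hwr, hgr⟩ := stdBr_spec deg f c y hylen hRight
    constructor
    · simp only [word]
      rw [hwl, hwr, hw]
    · simp only [Good]
      refine ⟨hgl, hgr, ?_⟩
      rw [hwl, hwr]
      exact dlex_append_swap deg (List.cons_ne_nil a u) (List.cons_ne_nil c y) (hw ▸ hL)

/-- The standard bracketing of a Lyndon word has that word as its leaf word. -/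
theorem word_standardBracketing (deg : ι → ℕ) {a : ι} {x : List ι}
    (h : IsLyndon deg (a :: x)) : word (standardBracketing deg a x) = a :: x :=
  (stdBr_spec deg x.length a x le_rfl h).1

/-- GOODNESS: the standard bracketing of a Lyndon word is a good tree. -/
theorem good_standardBracketing (deg : ι → ℕ) {a : ι} {x : List ι}
    (h : IsLyndon deg (a :: x)) : Good deg (standardBracketing deg a x) :=
  (stdBr_spec deg x.length a x le_rfl h).2

/-- (Λ2′) for the standard bracketing of a Lyndon word `w`: the reversed value word of every
signed arrangement of the iterated commutator is `⪰` the value word of `w`. -/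
theorem not_dlex_of_mem_terms_std {K : Type*} [CommRing K] (deg : ι → ℕ) {a : ι} {x : List ι}
    (h : IsLyndon deg (a :: x)) {p : K × List ι}
    (hp : p ∈ terms K (standardBracketing deg a x)) :
    ¬ DLex (p.2.map deg).reverse ((a :: x).map deg) := by
  have h' := not_dlex_of_mem_terms deg _ (good_standardBracketing deg h) hp
  rwa [word_standardBracketing deg h] at h'

/-- (Λ1′) for the standard bracketing of a Lyndon word `w` with `k` letters: the only signed
arrangement whose reversed value word equals that of `w` is `rev w`, with sign `(-1)^(k+1)`. -/
theorem eq_reverse_of_mem_terms_std {K : Type*} [CommRing K] (deg : ι → ℕ) {a : ι} {x : List ι}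
    (h : IsLyndon deg (a :: x)) {p : K × List ι}
    (hp : p ∈ terms K (standardBracketing deg a x))
    (heq : (p.2.map deg).reverse = (a :: x).map deg) :
    p.2 = (a :: x).reverse ∧ p.1 = (-1) ^ ((a :: x).length + 1) := by
  have h' := eq_reverse_of_mem_terms deg _ (good_standardBracketing deg h) hp
  rw [word_standardBracketing deg h] at h'
  exact h' heq

/-- Example (the word `5 5 3`, i.e. the block word `(3,5,5)` reversed): the standard bracketing
is right-nested, `[5, [5, 3]]`. -/
example : standardBracketing id 5 [5, 3] = node (leaf 5) (node (leaf 5) (leaf 3)) := rfl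

/-- Example (the word `5 3 3`, block word `(3,3,5)`): the standard bracketing is left-nested,
`[[5, 3], 3]`. -/
example : standardBracketing id 5 [3, 3] = node (node (leaf 5) (leaf 3)) (leaf 3) := rfl

end LyndonWords

end SoloBlind

end Summit.KontsevichZagierPeriods.KontsevichZagierPeriods.Theorems
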